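import Summits.QuantumFields.BalabanUV.Gaps.EndDrawdownBand
import Summits.QuantumFields.BalabanUV.Gaps.CapSignsConstRoad
import Summits.QuantumFields.BalabanUV.Gaps.CapTailPinnedLimitSign

/-!
# Gaps / EndDrawdownEverySlope — the drawdown node on row (D4)'s EVERY-SLOPE road: when the remainder constant can be taken below every
# positive number at the price of the box (`CapSignsConstRoad.EverySlope`, the tree's reading of [I] Thm 3's «γ depends on all other
# constants» ∕ (AF-1)), the two thresholds of the band COLLAPSE ONTO THE SIGN: `(∃ r > 0, DwSeq β⁰ r) ⟹ EndpointExistence ⟹ (∀ ε > 0,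
# DwSeq β⁰ (−ε))` — no (UP), no `−β′ ≤ β`, no rate, no pin; in a drift class at slope `L` (row (D1)'s shape): `0 < L ⟹ E ⟹ 0 ≤ L`; for a
# convergent one-loop part: `0 < lim ⟹ E` (and `E ⟹ 0 ≤ lim` is this seat's gen-5 `CapTailEndNecessity.binf_nonneg_of_endpointExistence'`, (U)-free, BY NAME); and the boundary IS undecided in one-loop currency (§4: two every-slope splits with
# the SAME one-loop part `β⁰ ≡ 0`, one with E and one without); §5 QUANTIFIES the road over realization classes (`EndForcedES` ∕ `EndPossibleES`):
# `(∃ r>0, DwSeq b r) ⟹ FORCED ⟹ DwSeq b 0 ⟹ POSSIBLE ⟹ (∀ ε>0, DwSeq b (−ε))`, in a drift class POSSIBLE ⟺ `0 ≤ L` EXACTLY and `0 < L ⟹ FORCED ⟹ 0 ≤ L`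
# (FORCED at `L = 0` fails for `b ≡ 0`), at the β-lead's pinned literal hypothesis-free with `L = M∞`.  The sufficiency side SHARPENS BY NAME this seat's gen-2
# `CapTailFloors.endpointExistence_of_eventualFloor_everySlope` (which asks (U) `BetaUpperH β′` and `−β′ ≤ β`): the printed two-sided letters DROP OUT of the
# every-slope road at END grade (the necessity side was already (U)-free in gen 5's `binf_nonneg_of_endpointExistence'`, used BY NAME) (this seat's own leaf on top of the port `Gaps/EndDrawdownBand`; cell
# pub-balaban-gaps, seat g1-p3 GEN 8, rows CAP ∕ tail «split ∕ weakening»; file 8 of «the one-loop interface of the END statement»)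

HONEST FRAMING (cell rule, page 1 of everything): two- to five-line compositions of tree theorems over hypothesis SHAPES (`EverySlope`, `DwSeq`,
`BetaContH`, `OneLoopDrift`, `EndpointExistence`); for Bałaban's split `EverySlope` is row (D4)'s located UNPRINTED currency (no supplier in print
or tree for the fixed split; suppliers by name in `CapSignsConstRoad` §1 are hypothesis carriers), the sign of the one-loop slope ∕ limit is rows
tail ∕ (D1)'s unprinted input: nothing of Bałaban's is asserted, no constant certified (NODE-O instance 0∕1, CAP coefficients certified 0);
0∕6 binders; one finite T⁴; NOT [I] Thm 2, NOT `BetaPertH`, NOT the continuum limit, NOT Clay.  The boundary `L = 0` (resp. `lim = 0`) is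
genuinely remainder-decided: §4 types it at END grade with two TOY families (gen 3's `CapFloorNotNecessary.boundary_decided_by_remainder` is the
(0.31)-grade analogue); §4's `betaN` ∕ `splitN` are toy definitions (definition lane), nothing of Bałaban's.

CITATION HEADER (tags CONTEXT ONLY).  [I] = T. Bałaban, Commun. Math. Phys. **109** (1987) 249–301 [Balaban1987RG1]: Thm 2 p. 259 (first
sentence), Thm 3 p. 264, §1 p. 264 ((AF-1), «uniformly bounded»), (1.22) p. 264, (2.12)–(2.14) p. 268.
-/

namespace Summit.QuantumFields.BalabanUV.Gaps.EndDrawdownEverySlope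

open Literature.MathematicalPhysics.QuantumFieldTheory.Balaban1983to89
open Literature.MathematicalPhysics.QuantumFieldTheory.Balaban1983to89.FlowStep
open Literature.MathematicalPhysics.QuantumFieldTheory.Balaban1983to89.FlowStepRuns
open Literature.MathematicalPhysics.QuantumFieldTheory.Balaban1983to89.DagBinding
open Literature.MathematicalPhysics.QuantumFieldTheory.Balaban1983to89.Beta.RemainderChain (RemainderConst)
open Literature.MathematicalPhysics.QuantumFieldTheory.Balaban1983to89.Beta.Drift (OneLoopDrift)
open Summit.QuantumFields.BalabanUV.Gaps.CapSignsConstRoad (EverySlope)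
open Literature.MathematicalPhysics.QuantumFieldTheory.Balaban1983to89.Beta.RateCertificate (CauchyRate)
open Literature.MathematicalPhysics.QuantumFieldTheory.Balaban1983to89.Beta.OneStepKernelFamily (TbalOf)
open Literature.MathematicalPhysics.QuantumFieldTheory.Balaban1983to89.Beta.AffineAveraging (box)
open Summit.QuantumFields.BalabanUV.Beta.MixedJetTablesPlug (JsBalAn1)
open Summit.QuantumFields.BalabanUV.Beta.GAN24.StencilSlotOfE3 (one_le_of_two_le)
open Summit.QuantumFields.BalabanUV.Gaps.CapTailPinnedLimitSign (exists_geomRate_pinned)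
open Summit.QuantumFields.BalabanUV.Gaps.EndDrawdownSeq
open Summit.QuantumFields.BalabanUV.Gaps.EndDrawdownBand
open Filter Topology Finset

noncomputable section

variable {β : HBeta}

/-! ## §1 Sufficiency on the every-slope road: ANY positive drawdown threshold (no (UP), no `−β′`, no rate) -/

/-- **END FROM A POSITIVE DRAWDOWN THRESHOLD ON THE EVERY-SLOPE ROAD** · forward generation ∧ `EverySlope Sβ γc` ∧ (C) on `]0,γc]` ∧ `DwSeq β⁰ r` for
SOME `r > 0` ⟹ `EndpointExistence`: choose the box `]0,γ]`, `γ ≤ γc`, on which the remainder constant is `r`, restrict (C), apply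
`EndDrawdownBand.endpointExistence_of_dwSeq_remainderConst`.  No (UP), no lower bound `−β′ ≤ β`, no rate, no pin, no B0.
[cite: Balaban1987RG1, Thm 2 p.259 (first sentence) and Thm 3 p.264] -/
theorem endpointExistence_of_dwSeq_pos_everySlope {Cn : B12.Construction} (hgen : ForwardGenerated Cn β) (Sβ : B12Beta.OneLoopSplit β)
    {γc r : ℝ} (hES : EverySlope Sβ γc) (hr : 0 < r) (hDw : DwSeq Sβ.β0 r) (hcont : BetaContH γc β) :
    EndpointExistence Cn := by
  obtain ⟨γ, hγ, hγle, hR⟩ := hES r hr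
  exact endpointExistence_of_dwSeq_remainderConst hgen Sβ hγ hDw hR fun k => (hcont k).mono (box_mono hγle k)

/-- **THE CAP-FREE TAIL-SIGN ROAD** · fwd-gen ∧ `EverySlope` ∧ (C) ∧ an EVENTUAL POSITIVE floor `0 < f ≤ β⁰_j` (`j ≥ k₀`) ⟹ E — sharpens this seat's gen-2
`CapTailFloors.endpointExistence_of_eventualFloor_everySlope` BY DROPPING its letters (U) `BetaUpperH β′ γc β` and `−β′ ≤ β`: on the every-slope road
the END statement reads of β only (C) and, of the one-loop coefficients, an eventual positive floor — nothing of the first `k₀`, no rate.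
[cite: Balaban1987RG1, Thm 2 p.259 (first sentence) and (2.12)–(2.14) p.268] -/
theorem endpointExistence_of_eventualFloor_pos_everySlope {Cn : B12.Construction} (hgen : ForwardGenerated Cn β)
    (Sβ : B12Beta.OneLoopSplit β) {γc f : ℝ} {k₀ : ℕ} (hES : EverySlope Sβ γc) (hf : 0 < f) (hF : ∀ j, k₀ ≤ j → f ≤ Sβ.β0 j)
    (hcont : BetaContH γc β) : EndpointExistence Cn :=
  endpointExistence_of_dwSeq_pos_everySlope hgen Sβ hES hf (dwSeq_of_eventually_ge hF) hcont

/-- DRIFT CLASS WITH POSITIVE SLOPE ⟹ E on the every-slope road (row (D1)'s shape with `0 < L`; the boundary threshold `r = L` is available by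
`dwSeq_of_oneLoopDrift`) — no (UP), no pin to a table, no identification of `L`. [cite: Balaban1987RG1, Thm 2 p.259 (first sentence) and (1.22) p.264] -/
theorem endpointExistence_of_oneLoopDrift_pos_everySlope {Cn : B12.Construction} (hgen : ForwardGenerated Cn β)
    (Sβ : B12Beta.OneLoopSplit β) {γc L A : ℝ} (hES : EverySlope Sβ γc) (hA : OneLoopDrift L A Sβ.β0) (hL : 0 < L)
    (hcont : BetaContH γc β) : EndpointExistence Cn :=
  endpointExistence_of_dwSeq_pos_everySlope hgen Sβ hES hL (dwSeq_of_oneLoopDrift hA le_rfl) hcont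

/-- CONVERGENT ONE-LOOP PART WITH POSITIVE LIMIT ⟹ E on the every-slope road (threshold `lim∕2`) — the (U)-free, rate-free form of this seat's gen-5
`CapTailPinnedLimitSign.endpointExistence_of_pinned_limPos` for ANY split. [cite: Balaban1987RG1, Thm 2 p.259 (first sentence) and (1.22) p.264] -/
theorem endpointExistence_of_tendsto_pos_everySlope {Cn : B12.Construction} (hgen : ForwardGenerated Cn β)
    (Sβ : B12Beta.OneLoopSplit β) {γc binf : ℝ} (hES : EverySlope Sβ γc) (hlim : Tendsto Sβ.β0 atTop (𝓝 binf)) (hpos : 0 < binf)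
    (hcont : BetaContH γc β) : EndpointExistence Cn :=
  endpointExistence_of_dwSeq_pos_everySlope hgen Sβ hES (half_pos hpos) (dwSeq_of_tendsto_lt hlim (half_lt_self hpos)) hcont

/-! ## §2 Necessity on the every-slope road: drawdown below EVERY negative line ((U)-free) -/

/-- **END GRADE ⟹ BOUNDED DRAWDOWN BELOW EVERY LINE OF NEGATIVE SLOPE** · fwd-gen ∧ `EverySlope Sβ γc` ∧ `EndpointExistence` ⟹ `∀ ε > 0, DwSeq β⁰ (−ε)`:
for each `ε` take the box on which the remainder constant is `ε` and apply the one-sided necessity `EndDrawdownBand.dwSeq_neg_of_endpointExistence_upper`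
(realised window inequality; (U)-free like gen 5's `CapTailEndNecessity.partialSum_noNegDrift_of_endpointExistence` ∕ `binf_nonneg_of_endpointExistence'`, here in
drawdown currency at every negative threshold).
[cite: Balaban1987RG1, (0.20) p.256 and Thm 2 p.259] -/
theorem dwSeq_neg_of_endpointExistence_everySlope {Cn : B12.Construction} (hgen : ForwardGenerated Cn β) (Sβ : B12Beta.OneLoopSplit β)
    {γc : ℝ} (hES : EverySlope Sβ γc) (hE : EndpointExistence Cn) {ε : ℝ} (hε : 0 < ε) : DwSeq Sβ.β0 (-ε) := by
  obtain ⟨γ, hγ, -, hR⟩ := hES ε hε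
  exact dwSeq_neg_of_endpointExistence_remainderConst hgen Sβ hγ hR hE

/-- DRIFT CLASS: E on the every-slope road forces a NONNEGATIVE slope, `0 ≤ L` ((U)-free; `dwSeq_iff_of_oneLoopDrift` at every `−ε`).
[cite: Balaban1987RG1, (0.20) p.256 and (1.22) p.264] -/
theorem slope_nonneg_of_endpointExistence_everySlope {Cn : B12.Construction} (hgen : ForwardGenerated Cn β) (Sβ : B12Beta.OneLoopSplit β)
    {γc L A : ℝ} (hES : EverySlope Sβ γc) (hA : OneLoopDrift L A Sβ.β0) (hE : EndpointExistence Cn) : 0 ≤ L := by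
  refine le_of_not_gt fun hneg => ?_
  have hε : 0 < -L / 2 := by linarith
  have h := (dwSeq_iff_of_oneLoopDrift hA (-(-L / 2))).mp (dwSeq_neg_of_endpointExistence_everySlope hgen Sβ hES hE hε)
  linarith

/-! ## §3 The every-slope sandwich: the band collapses onto the SIGN (boundary excluded) -/

/-- **THE EVERY-SLOPE SANDWICH** · fwd-gen ∧ `EverySlope Sβ γc` ∧ (C) on `]0,γc]`: `(∃ r > 0, DwSeq β⁰ r) ⟹ E ⟹ (∀ ε > 0, DwSeq β⁰ (−ε))` — the band of
`EndDrawdownBand` (width `rlo + rhi`) shrinks to the boundary layer at threshold `0`. [cite: Balaban1987RG1, Thm 2 p.259 (first sentence) and Thm 3 p.264] -/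
theorem endpointExistence_sandwich_everySlope {Cn : B12.Construction} (hgen : ForwardGenerated Cn β) (Sβ : B12Beta.OneLoopSplit β)
    {γc : ℝ} (hES : EverySlope Sβ γc) (hcont : BetaContH γc β) :
    ((∃ r : ℝ, 0 < r ∧ DwSeq Sβ.β0 r) → EndpointExistence Cn) ∧
      (EndpointExistence Cn → ∀ ε : ℝ, 0 < ε → DwSeq Sβ.β0 (-ε)) :=
  ⟨fun ⟨_, hr, hDw⟩ => endpointExistence_of_dwSeq_pos_everySlope hgen Sβ hES hr hDw hcont,
    fun hE _ hε => dwSeq_neg_of_endpointExistence_everySlope hgen Sβ hES hE hε⟩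

/-- **IN A DRIFT CLASS THE EVERY-SLOPE ROAD READS ONLY THE SIGN OF THE SLOPE**: `0 < L ⟹ E` and `E ⟹ 0 ≤ L` (fwd-gen, `EverySlope`, (C), row (D1)'s
shape at slope `L`); the boundary `L = 0` is remainder-decided (gen 3's `CapFloorNotNecessary.boundary_decided_by_remainder`).  At the β-lead's pinned
literal with `L = M∞` this is this seat's gen-5 pair `endpointExistence_of_pinned_limPos` ∕ `limNonneg_of_endpointExistence_pinned` with (U) ∕ (L)
dropped from BOTH sides. [cite: Balaban1987RG1, Thm 2 p.259 (first sentence) and (1.22) p.264] -/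
theorem endpointExistence_sign_sandwich_of_oneLoopDrift {Cn : B12.Construction} (hgen : ForwardGenerated Cn β)
    (Sβ : B12Beta.OneLoopSplit β) {γc L A : ℝ} (hES : EverySlope Sβ γc) (hA : OneLoopDrift L A Sβ.β0) (hcont : BetaContH γc β) :
    (0 < L → EndpointExistence Cn) ∧ (EndpointExistence Cn → 0 ≤ L) :=
  ⟨fun hL => endpointExistence_of_oneLoopDrift_pos_everySlope hgen Sβ hES hA hL hcont,
    fun hE => slope_nonneg_of_endpointExistence_everySlope hgen Sβ hES hA hE⟩

/-! ## §4 The boundary `L = 0` IS undecided in one-loop currency on the every-slope road (this seat; toy witnesses realised by `modelOf`) -/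

/-- The DECAYING-COUPLING toy remainder: `β_{k+1}(g_0,…,g_k) := −g_k` for `g_k > 0`, `0` otherwise (printed vanishing); one-loop part `0`.
Along its runs `1∕g_{k+1}² = 1∕g_k² + g_k`: the couplings DECREASE and `1∕g_K² ≥ K·g_K`, so no bare coupling reaches a fixed target at every cutoff.
A TOY on the tree's carrier. [folklore] -/
def betaN : HBeta := fun k p => if 0 < p (Fin.last k) then -(p (Fin.last k)) else 0

/-- Its printed split: `β⁰ ≡ 0`, `β¹ := betaN`. [folklore] -/
def splitN : B12Beta.OneLoopSplit betaN where
  β0 := fun _ => 0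
  β1 := betaN
  split := fun _ _ => (zero_add _).symm
  vanish := fun k p hp => by simp [betaN, hp]

/-- On a history with positive last coupling: `β_{k+1} = −g_k`. [folklore] -/
theorem betaN_of_pos (k : ℕ) {p : Fin (k + 1) → ℝ} (hp : 0 < p (Fin.last k)) : betaN k p = -(p (Fin.last k)) := by
  simp [betaN, hp]

/-- `splitN` is on the EVERY-SLOPE road on every box `]0,γc]` (`|β¹| ≤ γ ≤ s` on `]0, min s γc]`). [folklore] -/
theorem everySlope_splitN {γc : ℝ} (hγc : 0 < γc) : EverySlope splitN γc := by
  intro s hs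
  refine ⟨min s γc, lt_min hs hγc, min_le_right _ _, fun k p hp => ?_⟩
  have h := hp (Fin.last k)
  show |betaN k p| ≤ s
  rw [betaN_of_pos k h.1, abs_neg, abs_of_pos h.1]
  exact h.2.trans (min_le_left _ _)

/-- (C) for `betaN` on every box (it is `−g_k` there). [folklore] -/
theorem betaContH_betaN (γ : ℝ) : BetaContH γ betaN := fun k =>
  ((continuous_apply (Fin.last k)).neg.continuousOn).congr fun _ hp => betaN_of_pos k ((mem_box.mp hp) (Fin.last k)).1

/-- **NO END for `modelOf betaN`**: along an in-interval run of length `K`, `1∕g_0² + K·g_K ≤ 1∕g_K²`; a fixed target `g_K = g⋆` at every cutoff `K`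
would give `K·g⋆³ ≤ 1` for all `K`. [folklore] -/
theorem not_endpointExistence_betaN : ¬ EndpointExistence (modelOf betaN) := by
  intro hE
  obtain ⟨γ₂, hγ₂, h⟩ := hE 0
  obtain ⟨gstar, hgstar, h⟩ := h γ₂ hγ₂ le_rfl
  set K : ℕ := ⌈1 / gstar ^ 3⌉₊ + 1 with hK
  obtain ⟨g0, hI, hend⟩ := h gstar hgstar le_rfl K
  -- the run and its positivity up to `K`
  have hpos : ∀ k, k ≤ K → 0 < genSeq betaN g0 k := fun k hk => (hI k hk).1
  -- one RG step inside the run: `1∕g_{k+1}² = 1∕g_k² + g_k`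
  have hstep : ∀ k, k < K → 1 / (genSeq betaN g0 (k + 1)) ^ 2 = 1 / (genSeq betaN g0 k) ^ 2 + genSeq betaN g0 k := by
    intro k hk
    have hgk := hpos k hk.le
    have hβ : betaN k (prefixOf (genSeq betaN g0) k) = -(genSeq betaN g0 k) := by
      rw [betaN_of_pos k (by simpa using hgk)]
      simp
    have harg : 0 < 1 / (genSeq betaN g0 k) ^ 2 - betaN k (prefixOf (genSeq betaN g0) k) := by
      rw [hβ, sub_neg_eq_add]
      exact add_pos (one_div_pos.mpr (pow_pos hgk 2)) hgk
    rw [genSeq_succ, inv_sq_solveCoupling harg, hβ]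
    ring
  -- invariant: `1∕g_0² + n·g_n ≤ 1∕g_n²` for `n ≤ K`
  have key : ∀ n, n ≤ K → 1 / g0 ^ 2 + n * genSeq betaN g0 n ≤ 1 / (genSeq betaN g0 n) ^ 2 := by
    intro n
    induction n with
    | zero => intro _; simp [genSeq_zero]
    | succ n ih =>
      intro hn
      have hn' : n < K := Nat.lt_of_succ_le hn
      have ih' := ih hn'.le
      have hs := hstep n hn'
      have hgn := hpos n hn'.le
      have hgn1 := hpos (n + 1) hn
      have hsq : (genSeq betaN g0 (n + 1)) ^ 2 ≤ (genSeq betaN g0 n) ^ 2 := by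
        have h1 : 1 / (genSeq betaN g0 n) ^ 2 ≤ 1 / (genSeq betaN g0 (n + 1)) ^ 2 := by rw [hs]; linarith
        exact (one_div_le_one_div (pow_pos hgn 2) (pow_pos hgn1 2)).mp h1
      have hmono : genSeq betaN g0 (n + 1) ≤ genSeq betaN g0 n := by
        nlinarith [add_pos hgn1 hgn]
      push_cast
      nlinarith [ih', hs, hmono]
  have hfin := key K le_rfl
  have hgK : genSeq betaN g0 K = gstar := hend
  rw [hgK] at hfin
  have hg0 : 0 < 1 / g0 ^ 2 := by
    have := hpos 0 (Nat.zero_le _)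
    rw [genSeq_zero] at this
    positivity
  have hKs : (K : ℝ) * gstar ≤ 1 / gstar ^ 2 := by linarith
  have hK3 : (K : ℝ) * gstar ^ 3 ≤ 1 := by
    have := mul_le_mul_of_nonneg_right hKs (pow_pos hgstar 2).le
    rwa [one_div_mul_cancel (pow_ne_zero 2 hgstar.ne'), mul_assoc, ← pow_succ'] at this
  have hKgt : 1 / gstar ^ 3 < (K : ℝ) := by
    rw [hK]; push_cast
    exact (Nat.le_ceil _).trans_lt (lt_add_one _)
  have : 1 < (K : ℝ) * gstar ^ 3 := by
    have h3 : 0 < gstar ^ 3 := pow_pos hgstar 3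
    have := mul_lt_mul_of_pos_right hKgt h3
    rwa [one_div_mul_cancel h3.ne'] at this
  linarith

/-- **THE BOUNDARY IS UNDECIDED IN ONE-LOOP CURRENCY ON THE EVERY-SLOPE ROAD** · two printed splits with the SAME one-loop part `β⁰ ≡ 0` (drift class of
slope `0`: the boundary of §3's sign sandwich), both on the every-slope road on `]0,γc]`, both (C) on every box, both realised by the tree's canonical
forward-generated construction: the zero remainder HAS `EndpointExistence` (`EndDrawdownBand`'s witness `betaShift 0 0`, constant couplings), the
decaying-coupling remainder `betaN` has NOT.  At `L = 0` the END statement is decided by the remainder, by nothing one-loop. [folklore] -/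
theorem everySlope_boundary_undecided {γc : ℝ} (hγc : 0 < γc) :
    (∃ (β : HBeta) (Sβ : B12Beta.OneLoopSplit β), (∀ j, Sβ.β0 j = 0) ∧ EverySlope Sβ γc ∧ (∀ γ, BetaContH γ β) ∧
        ForwardGenerated (modelOf β) β ∧ EndpointExistence (modelOf β)) ∧
      ∃ (β : HBeta) (Sβ : B12Beta.OneLoopSplit β), (∀ j, Sβ.β0 j = 0) ∧ EverySlope Sβ γc ∧ (∀ γ, BetaContH γ β) ∧
        ForwardGenerated (modelOf β) β ∧ ¬ EndpointExistence (modelOf β) := by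
  refine ⟨⟨betaShift (fun _ => 0) 0, splitShift (fun _ => 0) 0, fun _ => rfl, fun s hs => ⟨γc, hγc, le_rfl, ?_⟩,
      fun γ => betaContH_betaShift _ 0 γ, modelOf_forwardGenerated _, ?_⟩,
    ⟨betaN, splitN, fun _ => rfl, everySlope_splitN hγc, betaContH_betaN, modelOf_forwardGenerated _, not_endpointExistence_betaN⟩⟩
  · exact remainderConst_splitShift _ (abs_zero.le.trans hs.le) γc
  · exact endpointExistence_of_dwSeq_remainderConst (modelOf_forwardGenerated _) (splitShift (fun _ => 0) 0) hγc
      (dwSeq_of_forall_le fun _ => le_rfl) (remainderConst_splitShift _ (abs_zero.le) γc) (betaContH_betaShift _ 0 γc)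

/-! ## §5 The every-slope road QUANTIFIED over realization classes (this seat): FORCED ∕ POSSIBLE versus the drawdown thresholds `r > 0`, `0`, `−ε` -/

/-- QUANTIFIED READING (universal) on the every-slope road · E for EVERY realization of the one-loop sequence `b` whose split is on the every-slope road on
`]0,γc]` (`EverySlope Sβ γc`), (C) on the `]0,γc]`-boxes, any forward-generated construction.  A reading over Bałaban-free data `(b, γc)`; not a binder.
[cite: Balaban1987RG1, Thm 2 p.259 (first sentence) and Thm 3 p.264] -/
def EndForcedES (b : ℕ → ℝ) (γc : ℝ) : Prop :=
  ∀ (β : HBeta) (Sβ : B12Beta.OneLoopSplit β) (Cn : B12.Construction),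
    (∀ j, Sβ.β0 j = b j) → EverySlope Sβ γc → BetaContH γc β → ForwardGenerated Cn β → EndpointExistence Cn

/-- QUANTIFIED READING (existential) on the every-slope road · SOME realization of `(b, γc)` on the road has E. [cite: Balaban1987RG1, Thm 2 p.259 (first sentence) and Thm 3 p.264] -/
def EndPossibleES (b : ℕ → ℝ) (γc : ℝ) : Prop :=
  ∃ (β : HBeta) (Sβ : B12Beta.OneLoopSplit β) (Cn : B12.Construction),
    (∀ j, Sβ.β0 j = b j) ∧ EverySlope Sβ γc ∧ BetaContH γc β ∧ ForwardGenerated Cn β ∧ EndpointExistence Cn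

/-- The ZERO-remainder realization of `b` (`EndDrawdownBand.splitShift b 0`) is on the every-slope road on every box. [folklore] -/
theorem everySlope_splitShift_zero (b : ℕ → ℝ) {γc : ℝ} (hγc : 0 < γc) : EverySlope (splitShift b 0) γc :=
  fun _ hs => ⟨γc, hγc, le_rfl, remainderConst_splitShift b (abs_zero.le.trans hs.le) γc⟩

/-- (1) A POSITIVE drawdown threshold forces E over the every-slope class (§1 on each realization). [cite: Balaban1987RG1, Thm 2 p.259 (first sentence) and Thm 3 p.264] -/
theorem endForcedES_of_dwSeq_pos {b : ℕ → ℝ} {γc r : ℝ} (hr : 0 < r) (hDw : DwSeq b r) : EndForcedES b γc := by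
  intro β Sβ Cn hb hES hcont hgen
  have hDw' : DwSeq Sβ.β0 r := by
    obtain ⟨M, hM⟩ := hDw
    exact ⟨M, fun k n hkn => by simpa only [hb] using hM k n hkn⟩
  exact endpointExistence_of_dwSeq_pos_everySlope hgen Sβ hES hr hDw' hcont

/-- (2) FORCED over the every-slope class ⟹ `DwSeq b 0`: the zero-remainder realization (`modelOf (betaShift b 0)`) is on the road, and its E forces
`DwSeq b (−0)` by the realised window inequality. [cite: Balaban1987RG1, (0.20) p.256 and Thm 2 p.259] -/
theorem dwSeq_zero_of_endForcedES {b : ℕ → ℝ} {γc : ℝ} (hγc : 0 < γc) (h : EndForcedES b γc) : DwSeq b 0 := by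
  have hE : EndpointExistence (modelOf (betaShift b 0)) :=
    h _ (splitShift b 0) _ (fun _ => rfl) (everySlope_splitShift_zero b hγc) (betaContH_betaShift b 0 γc) (modelOf_forwardGenerated _)
  simpa using dwSeq_of_endpointExistence_betaShift (modelOf_forwardGenerated _) hE

/-- (3) `DwSeq b 0` ⟹ E POSSIBLE over the every-slope class: the zero-remainder realization has E (`RemainderConst … 0` on `]0,γc]`, the node at threshold 0).
[cite: Balaban1987RG1, Thm 2 p.259 (first sentence)] -/
theorem endPossibleES_of_dwSeq_zero {b : ℕ → ℝ} {γc : ℝ} (hγc : 0 < γc) (hDw : DwSeq b 0) : EndPossibleES b γc :=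
  ⟨betaShift b 0, splitShift b 0, modelOf (betaShift b 0), fun _ => rfl, everySlope_splitShift_zero b hγc, betaContH_betaShift b 0 γc,
    modelOf_forwardGenerated _,
    endpointExistence_of_dwSeq_remainderConst (modelOf_forwardGenerated _) (splitShift b 0) hγc hDw
      (remainderConst_splitShift b abs_zero.le γc) (betaContH_betaShift b 0 γc)⟩

/-- (4) POSSIBLE over the every-slope class ⟹ bounded drawdown below EVERY negative line (§2 on the realization). [cite: Balaban1987RG1, (0.20) p.256 and Thm 2 p.259] -/
theorem dwSeq_neg_of_endPossibleES {b : ℕ → ℝ} {γc : ℝ} (h : EndPossibleES b γc) {ε : ℝ} (hε : 0 < ε) : DwSeq b (-ε) := by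
  obtain ⟨β, Sβ, Cn, hb, hES, -, hgen, hE⟩ := h
  obtain ⟨M, hM⟩ := dwSeq_neg_of_endpointExistence_everySlope hgen Sβ hES hE hε
  exact ⟨M, fun k n hkn => by simpa only [hb] using hM k n hkn⟩

/-- **THE EVERY-SLOPE CHAIN** (`0 < γc`) · `(∃ r > 0, DwSeq b r) ⟹ FORCED ⟹ DwSeq b 0 ⟹ POSSIBLE ⟹ (∀ ε > 0, DwSeq b (−ε))`.  The middle implication is
STRICT (`b ≡ 0`: `DwSeq 0 0` yet not forced, `not_endForcedES_zero`); whether the two outer implications are equivalences is NOT decided here (recorded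
open in the seat's census). [cite: Balaban1987RG1, Thm 2 p.259 (first sentence) and Thm 3 p.264] -/
theorem everySlope_chain (b : ℕ → ℝ) {γc : ℝ} (hγc : 0 < γc) :
    ((∃ r : ℝ, 0 < r ∧ DwSeq b r) → EndForcedES b γc) ∧ (EndForcedES b γc → DwSeq b 0) ∧
      (DwSeq b 0 → EndPossibleES b γc) ∧ (EndPossibleES b γc → ∀ ε : ℝ, 0 < ε → DwSeq b (-ε)) :=
  ⟨fun ⟨_, hr, hDw⟩ => endForcedES_of_dwSeq_pos hr hDw, dwSeq_zero_of_endForcedES hγc, endPossibleES_of_dwSeq_zero hγc,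
    fun h _ hε => dwSeq_neg_of_endPossibleES h hε⟩

/-- STRICTNESS OF THE MIDDLE LINK · `b ≡ 0` has `DwSeq 0 0` but is NOT forced over the every-slope class (§4's decaying-coupling remainder `betaN`).
[folklore] -/
theorem not_endForcedES_zero {γc : ℝ} (hγc : 0 < γc) : DwSeq (fun _ : ℕ => (0 : ℝ)) 0 ∧ ¬ EndForcedES (fun _ : ℕ => (0 : ℝ)) γc :=
  ⟨dwSeq_of_forall_le fun _ => le_rfl,
    fun h => not_endpointExistence_betaN (h betaN splitN _ (fun _ => rfl) (everySlope_splitN hγc) (betaContH_betaN γc)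
      (modelOf_forwardGenerated _))⟩

/-- **IN A DRIFT CLASS, POSSIBLE IS EXACT ON THE EVERY-SLOPE ROAD: `EndPossibleES b γc ⟺ 0 ≤ L`** (slope `L`, `0 < γc`; boundary INCLUDED on both sides:
⟸ by `dwSeq_of_oneLoopDrift` at threshold `0 ≤ L`, ⟹ by `−ε ≤ L` for every `ε > 0`). [cite: Balaban1987RG1, Thm 2 p.259 (first sentence) and (1.22) p.264] -/
theorem endPossibleES_iff_of_oneLoopDrift {b : ℕ → ℝ} {γc L A : ℝ} (hγc : 0 < γc) (hA : OneLoopDrift L A b) :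
    EndPossibleES b γc ↔ 0 ≤ L := by
  refine ⟨fun h => le_of_not_gt fun hneg => ?_, fun hL => endPossibleES_of_dwSeq_zero hγc (dwSeq_of_oneLoopDrift hA hL)⟩
  have hε : 0 < -L / 2 := by linarith
  have := (dwSeq_iff_of_oneLoopDrift hA (-(-L / 2))).mp (dwSeq_neg_of_endPossibleES h hε)
  linarith

/-- IN A DRIFT CLASS, FORCED ON THE EVERY-SLOPE ROAD READS THE SIGN OF THE SLOPE UP TO THE BOUNDARY: `0 < L ⟹ EndForcedES b γc ⟹ 0 ≤ L`; at `L = 0`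
FORCED can fail (`not_endForcedES_zero`). [cite: Balaban1987RG1, Thm 2 p.259 (first sentence) and (1.22) p.264] -/
theorem endForcedES_sign_of_oneLoopDrift {b : ℕ → ℝ} {γc L A : ℝ} (hγc : 0 < γc) (hA : OneLoopDrift L A b) :
    (0 < L → EndForcedES b γc) ∧ (EndForcedES b γc → 0 ≤ L) :=
  ⟨fun hL => endForcedES_of_dwSeq_pos hL (dwSeq_of_oneLoopDrift hA le_rfl),
    fun h => (dwSeq_iff_of_oneLoopDrift hA 0).mp (dwSeq_zero_of_endForcedES hγc h)⟩

/-- **AT THE β-LEAD's PINNED LITERAL, HYPOTHESIS-FREE** (the table's one-loop sequence lies in the drift class of slope `M∞ := CauchyRate.lim β⁰_table`,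
this seat's gen-5 `CapTailPinnedLimitSign.exists_geomRate_pinned`): over ALL T0-pinned splits on the every-slope road on `]0,γc]` with (C), E is
POSSIBLE ⟺ `0 ≤ M∞`, and `0 < M∞ ⟹` E FORCED `⟹ 0 ≤ M∞` — gen 5's pinned pair (`endpointExistence_of_pinned_limPos` ∕ `limNonneg_of_endpointExistence_pinned`)
QUANTIFIED and with (U) ∕ (L) dropped.  No value or sign of `M∞` is certified. [cite: Balaban1987RG1, Thm 2 p.259 (first sentence) and (1.22) p.264] -/
theorem everySlope_pinned_sign {Lc : ℕ} [NeZero Lc] (hLc : 2 ≤ Lc) {r : Fin (3 + 1) → ℕ} (hr : r ∈ box (3 + 1) Lc) (cE cVH cΛ cB : ℝ)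
    (Tc : Fin 4 → Fin 4 → Fin 4 → Fin 4 → ℝ) (μ ν : Fin 4) {γc : ℝ} (hγc : 0 < γc) :
    (EndPossibleES (fun j => B12Beta.secondMoment
        (TbalOf Lc (JsBalAn1 (one_le_of_two_le hLc) hr cE cVH cΛ ((Lc : ℝ) ^ (2 * (3 + 1))) cB Tc) j) μ ν) γc ↔
      0 ≤ CauchyRate.lim fun j =>
        B12Beta.secondMoment (TbalOf Lc (JsBalAn1 (one_le_of_two_le hLc) hr cE cVH cΛ ((Lc : ℝ) ^ (2 * (3 + 1))) cB Tc) j) μ ν) ∧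
    ((0 < CauchyRate.lim fun j =>
        B12Beta.secondMoment (TbalOf Lc (JsBalAn1 (one_le_of_two_le hLc) hr cE cVH cΛ ((Lc : ℝ) ^ (2 * (3 + 1))) cB Tc) j) μ ν) →
      EndForcedES (fun j => B12Beta.secondMoment
        (TbalOf Lc (JsBalAn1 (one_le_of_two_le hLc) hr cE cVH cΛ ((Lc : ℝ) ^ (2 * (3 + 1))) cB Tc) j) μ ν) γc) ∧
    (EndForcedES (fun j => B12Beta.secondMoment
        (TbalOf Lc (JsBalAn1 (one_le_of_two_le hLc) hr cE cVH cΛ ((Lc : ℝ) ^ (2 * (3 + 1))) cB Tc) j) μ ν) γc →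
      0 ≤ CauchyRate.lim fun j =>
        B12Beta.secondMoment (TbalOf Lc (JsBalAn1 (one_le_of_two_le hLc) hr cE cVH cΛ ((Lc : ℝ) ^ (2 * (3 + 1))) cB Tc) j) μ ν) := by
  obtain ⟨c₀, θ, hθ0, hθ1, hG⟩ := exists_geomRate_pinned hLc hr cE cVH cΛ cB Tc μ ν
  have hA := hG.drift hθ0 hθ1
  exact ⟨endPossibleES_iff_of_oneLoopDrift hγc hA, (endForcedES_sign_of_oneLoopDrift hγc hA).1, (endForcedES_sign_of_oneLoopDrift hγc hA).2⟩

end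

end Summit.QuantumFields.BalabanUV.Gaps.EndDrawdownEverySlope
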